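import Summits.BirchSwinnertonDyer.BirchSwinnertonDyer.Theorems.UniversalToricDescentTwinChoiceByName
import Summits.BirchSwinnertonDyer.BirchSwinnertonDyer.Theorems.UniversalToricDescentHessianTwinSupplyAtThree
import HarnessLib

/-!
# Route `UniversalToricDescent`, crux #3 (item stmt-BirchSwinnertonDyer-20695): the twin leaf BY NAME from the `a₃ = 0` half of bucket C — NO supply hypothesis (the supply is a theorem)

Cell `bsd-wall` (W-ALL lane 3, row 2·3@3), seat `bsd-wall-utd-p2` g7 (LEAD on 20695), 2026-08-28.
`--supports stmt-BirchSwinnertonDyer-20695`. Pure logic over g6's `UniversalToricDescentTwinChoiceByName.lean`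
(p579334/p579882: `wAllExclAddWildRankOneSurjTwin_of_apZero_of_supply`, `bsdp_three_of_apZero_of_supply`) and g7's
`UniversalToricDescentHessianTwinSupplyAtThree.lean` (`hasGoodSSApZeroTwinAtThree_of_hasGoodSSTwinAtThree`: the supply
`∀ W, HasGoodSSTwinAtThree W → HasGoodSSApZeroTwinAtThree W` is PROVED — Hessian of the Hessian).

WHAT IS PROVED.
* `wAllExclAddWildRankOneSurjTwin_of_apZero`: {`ToricPublishedInputs`, `ToricTransportModThree` (crux 20186),
  `TwinSplitIMCAtThreePrintedFacts` (bucket A's three refereed facts), `TwinSplitIMCAtThreeGoodOrdOfPrint` (closed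
  20693), `TwinSplitIMCAtThreeMult` (crux 20694), **the `a₃ = 0` HALF of item 20695**
  (`∀ W′, GoodSS W′ 3 → W′.frobeniusTrace 3 = 0 → ρ̄₃ onto → TwinIMCAtThreeAt W′`), `WildSplitWaldspurgerAtThree`,
  `WildSplitControlAtThree`, `WildRankZeroTwistAtThree`} ⟹ `WAllExclAddWildRankOneSurjTwin`.
* `bsdp_three_of_apZero`: the same with the kernel's conclusion (every curve of the attacked cell gets `BSD₃`).
* `wAllExclAddWildRankOneSurjTwin_of_goodApZero`: the same with the `a₃ = 0` half in «good ∧ `a₃ = 0`» shape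
  (utd-idea g9's `TwinSplitIMCAtThreeGoodSSZero` shape; `apZeroHalf_iff_goodApZeroHalf`).

READING. In the route's kernel, item 20695 `TwinSplitIMCAtThreeGoodSS` may be REPLACED by its `a₃ = 0` half — for EVERY curve,
with NO supply item and NO `3`-adic type restriction: the `a₃ = ±3` half (preprint-only ♯/♭, memo v8 §2) and the even-`d_K`
child 20696 are off the W-ALL critical path unconditionally. TURNKEY for the steward (memo SUPSET-AT3-v10 §5, now simpler):
re-key `closes` through `UniversalToricDescentHessianTwin.wAllExclAddWildRankOneSurjTwin_of_apZero hF hT hP hA hB hC0 hV hC hZ`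
with a new crux `TwinSplitIMCAtThreeGoodSSApZero` (text = `hC0`'s type) replacing 20695; no supply item.

HONEST FRAMING: conditional results (the kernel's named inputs and the `a₃ = 0` half are hypotheses BY NAME), pure logic;
nothing closes; no statement item filed (D-0014); BSD is not proved for any curve; beyond-print BSD theorem: NO.
-/

set_option autoImplicit false
set_option linter.dupNamespace false

noncomputable section

open scoped Classical

namespace Summit.BirchSwinnertonDyer.BirchSwinnertonDyer.Theorems.UniversalToricDescentHessianTwin

open WeierstrassCurve NumberField IsDedekindDomain Field
  Literature.NumberTheory.EllipticCurves
  Literature.NumberTheory.EllipticCurves.ModularForms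
  Literature.NumberTheory.EllipticCurves.Rank1Residual
  Summit.BirchSwinnertonDyer.Rank1Residual
  Summit.BirchSwinnertonDyer.Rank1Residual.X11b
  Summit.BirchSwinnertonDyer.Rank1Residual.X11b.AcSelmer
  Summit.BirchSwinnertonDyer.Rank1Residual.X11b.Halves
  Summit.BirchSwinnertonDyer.BirchSwinnertonDyer.Theses.UniversalToricDescent
  Summit.BirchSwinnertonDyer.BirchSwinnertonDyer.Theorems
  Summit.BirchSwinnertonDyer.BirchSwinnertonDyer.Theorems.UniversalToricDescentTwinChoice

/-- **The twin leaf BY NAME from the `a₃ = 0` half of bucket C — no supply hypothesis.** Published inputs, transport,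
printed facts (bucket A) + the closed child `TwinSplitIMCAtThreeGoodOrdOfPrint`, bucket B's crux, the `a₃ = 0` half of
bucket C, Waldspurger frame, control, rank-zero twist ⟹ `WAllExclAddWildRankOneSurjTwin`. (g6's
`wAllExclAddWildRankOneSurjTwin_of_apZero_of_supply` with the supply DISCHARGED by
`hasGoodSSApZeroTwinAtThree_of_hasGoodSSTwinAtThree`.) [folklore] -/
theorem wAllExclAddWildRankOneSurjTwin_of_apZero (hF : ToricPublishedInputs)
    (hT : ToricTransportModThree) (hP : TwinSplitIMCAtThreePrintedFacts)
    (hA : TwinSplitIMCAtThreeGoodOrdOfPrint) (hB : TwinSplitIMCAtThreeMult)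
    (hC0 : ∀ (W' : WeierstrassCurve ℚ) [W'.IsElliptic] [W'.IsGloballyMinimal],
      GoodSS W' 3 → W'.frobeniusTrace 3 = 0 → W'.HasSurjectiveModNGaloisRep 3 → TwinIMCAtThreeAt W')
    (hV : WildSplitWaldspurgerAtThree) (hC : WildSplitControlAtThree) (hZ : WildRankZeroTwistAtThree) :
    Summit.BirchSwinnertonDyer.WAllExclAddWildRankOneSurjTwin :=
  wAllExclAddWildRankOneSurjTwin_of_apZero_of_supply hF hT hP hA hB hC0
    (fun W _ _ h ↦ hasGoodSSApZeroTwinAtThree_of_hasGoodSSTwinAtThree W h) hV hC hZ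

/-- **Kernel conclusion from the `a₃ = 0` half of bucket C — no supply hypothesis**: every curve of the attacked cell
(`ClassO6`, `r_an = 1`, `ρ̄₃` onto, with a semistable onto twin) gets `BSD₃`. [folklore] -/
theorem bsdp_three_of_apZero (hF : ToricPublishedInputs)
    (hT : ToricTransportModThree) (hP : TwinSplitIMCAtThreePrintedFacts)
    (hA : TwinSplitIMCAtThreeGoodOrdOfPrint) (hB : TwinSplitIMCAtThreeMult)
    (hC0 : ∀ (W' : WeierstrassCurve ℚ) [W'.IsElliptic] [W'.IsGloballyMinimal],
      GoodSS W' 3 → W'.frobeniusTrace 3 = 0 → W'.HasSurjectiveModNGaloisRep 3 → TwinIMCAtThreeAt W')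
    (hV : WildSplitWaldspurgerAtThree) (hC : WildSplitControlAtThree) (hZ : WildRankZeroTwistAtThree) :
    ∀ (W : WeierstrassCurve ℚ) [W.IsElliptic] [W.IsGloballyMinimal], Additive.ClassO6 W 3 →
      W.analyticRank = 1 → W.HasSurjectiveModNGaloisRep 3 →
      (∃ (W' : WeierstrassCurve ℚ) (_ : W'.IsElliptic) (_ : W'.IsGloballyMinimal),
        O6.ModPCongruent W' W 3 ∧ ¬ Addv W' 3 ∧ W'.HasSurjectiveModNGaloisRep 3) → BSDp W 3 :=
  bsdp_three_of_apZero_of_supply hF hT hP hA hB hC0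
    (fun W _ _ h ↦ hasGoodSSApZeroTwinAtThree_of_hasGoodSSTwinAtThree W h) hV hC hZ

/-- **The twin leaf BY NAME from the `a₃ = 0` half in «good ∧ `a₃ = 0`» shape** (utd-idea g9's
`TwinSplitIMCAtThreeGoodSSZero` shape) — no supply hypothesis. [folklore] -/
theorem wAllExclAddWildRankOneSurjTwin_of_goodApZero (hF : ToricPublishedInputs)
    (hT : ToricTransportModThree) (hP : TwinSplitIMCAtThreePrintedFacts)
    (hA : TwinSplitIMCAtThreeGoodOrdOfPrint) (hB : TwinSplitIMCAtThreeMult)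
    (hG0 : ∀ (W' : WeierstrassCurve ℚ) [W'.IsElliptic] [W'.IsGloballyMinimal],
      W'.HasGoodReductionAtPrime 3 → W'.frobeniusTrace 3 = 0 → W'.HasSurjectiveModNGaloisRep 3 →
        TwinIMCAtThreeAt W')
    (hV : WildSplitWaldspurgerAtThree) (hC : WildSplitControlAtThree) (hZ : WildRankZeroTwistAtThree) :
    Summit.BirchSwinnertonDyer.WAllExclAddWildRankOneSurjTwin :=
  wAllExclAddWildRankOneSurjTwin_of_apZero hF hT hP hA hB (apZeroHalf_iff_goodApZeroHalf.2 hG0) hV hC hZ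

end Summit.BirchSwinnertonDyer.BirchSwinnertonDyer.Theorems.UniversalToricDescentHessianTwin

end
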